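import Summits.KontsevichZagierPeriods.KontsevichZagierPeriods.Theses.FurushoPentagon

/-!
# Route FurushoPentagon — `KernelImpliesReduced`: the kernel form forces a reduced period ring

Problem `KontsevichZagierPeriods`, route `FurushoPentagon`, item stmt-KontsevichZagierPeriods-11125
(`KernelImpliesReduced`, support). The formal period ring is `P := KZ.FormalRep ⧸ KZ.relations`
(formal `ℤ`-combinations of Kontsevich–Zagier integral representations modulo the subgroup
generated by the four moves; product = Fubini product of representations). The item records that
the crux `ReducedPeriodRing` ("`P` has no nilpotents": `c * c ∈ KZ.relations → c ∈ KZ.relations`)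
is *necessary* for Kontsevich–Zagier's Conjecture 1 in kernel form
(`∀ c, KZ.eval c = 0 → c ∈ KZ.relations`): if `c * c` is a relation then, by soundness of the
moves (`KZ.relations_le_ker_eval_holds`, [Kontsevich–Zagier 2001, §1.2]) and multiplicativity of
evaluation for the Fubini product (`KZ.eval_mul'`), `(KZ.eval c)² = KZ.eval (c * c) = 0`, so
`KZ.eval c = 0` because `ℝ` has no zero divisors, and the kernel hypothesis puts `c` in
`KZ.relations`.

Sources: M. Kontsevich, D. Zagier, *Periods* (2001), §1.2 (Conjecture 1 and the soundness of the
rules); J. Ayoub, *Periods and the conjectures of Grothendieck and Kontsevich–Zagier*, EMS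
Newsl. 91 (2014), §2 (ring structure on formal periods). Deliberately NOT here: any claim about
the kernel form or about reducedness themselves — the result is the implication only.
-/

namespace Summit.KontsevichZagierPeriods.FurushoPentagon

open Literature.NumberTheory.Transcendental

/-- Kernel form ⇒ reducedness, written against the Literature vocabulary: if every formal
combination `c` of integral representations with `KZ.eval c = 0` lies in `KZ.relations`, then
`c * c ∈ KZ.relations → c ∈ KZ.relations` for every `c : KZ.FormalRep`. Proof:
`KZ.eval (c * c) = 0` by soundness of the moves, `= KZ.eval c * KZ.eval c` by multiplicativity
of `KZ.eval`, hence `KZ.eval c = 0` in the domain `ℝ` (`mul_self_eq_zero`), and the hypothesis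
applies. [Kontsevich–Zagier 2001, §1.2] [folklore] -/
theorem mem_relations_of_mul_self_mem_of_kernel
    (hK : ∀ c : KZ.FormalRep, KZ.eval c = 0 → c ∈ KZ.relations)
    (c : KZ.FormalRep) (hcc : c * c ∈ KZ.relations) : c ∈ KZ.relations := by
  apply hK
  have h : KZ.eval (c * c) = 0 := KZ.relations_le_ker_eval_holds hcc
  rw [KZ.eval_mul'] at h
  exact mul_self_eq_zero.mp h

/-- Settles stmt-KontsevichZagierPeriods-11125: the route declaration
`FurushoPentagon.KernelImpliesReduced` — the kernel form of Conjecture 1 (spelled by its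
definiens) implies that the formal period ring `KZ.FormalRep ⧸ KZ.relations` is reduced
(`c * c ∈ KZ.relations → c ∈ KZ.relations`) — holds; it is
`mem_relations_of_mul_self_mem_of_kernel` read through the route's definition. Documents that the
crux `ReducedPeriodRing` cannot fail unless Conjecture 1 does. [folklore] -/
theorem kernelImpliesReduced_proof :
    Summit.KontsevichZagierPeriods.KontsevichZagierPeriods.Theses.FurushoPentagon.KernelImpliesReduced := by
  unfold Summit.KontsevichZagierPeriods.KontsevichZagierPeriods.Theses.FurushoPentagon.KernelImpliesReduced
  exact mem_relations_of_mul_self_mem_of_kernel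

end Summit.KontsevichZagierPeriods.FurushoPentagon
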